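import Mathlib.Analysis.Calculus.Deriv.MeanValue
import Mathlib.Analysis.SpecialFunctions.Log.Deriv
import Mathlib.MeasureTheory.Integral.ExpDecay
import Literature.Analysis.FluidPDE.ElgindiStabilityDecompositionProofs
import HarnessLib

/-!
# The stable modulated blow-up solution of Elgindi–Ghoul–Masmoudi (Theorem 2 with the §2.6 datum,
and `T_* = ∫₀^∞ λ < ∞` of Corollary 2.2) from the stability core — record of the merged named fact
`ElgindiGhoulMasmoudi2021_stableBlowupPhysical`

Topic `Literature/Analysis/FluidPDE`. Fourth file of the self-similar framework
(`ElgindiFundamentalModel.lean`, `ElgindiWeightedSpaces.lean`, `ElgindiSelfSimilarEquations.lean`,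
`ElgindiStabilityDecomposition.lean`) on the Elgindi–Ghoul–Masmoudi line to the target **ns.S29 (i)**
`Literature.Analysis.FluidPDE.elgindi_euler_blowup` (`Axisymmetric.lean`; proved glue in
`ElgindiBlowupSolutionProofs.lean`, `elgindi_euler_blowup_of_stableBlowupPhysical`).
Sources: `[ElgindiGhoulMasmoudi2021]` = Elgindi–Ghoul–Masmoudi, Camb. J. Math. 9 (2021),
arXiv:1910.14071; `[Elgindi2021]` = Elgindi, Ann. of Math. 194 (2021), arXiv:1904.04795 ("p." =
chunk of the held texts). Everything here is **proved**; the file declares no definition and no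
named fact.

## What is proved

`Elgindi.stableModulatedSolution_of_core`: from the named fact
`Elgindi.ElgindiGhoulMasmoudi2021_stabilityCore` (Elgindi's profile + [ElgindiGhoulMasmoudi2021]
§2.5 Thm 2 for it, swirl-free, `k = 4`) and the discharged
`Elgindi.ElgindiGhoulMasmoudi2021_compactSupportDatum` (§2.6), for every `0 < α < α₀`: a profile
`(F, Φ_F, δ)` (`Elgindi.IsProfile`) with an amplitude `a`, `|a − 1| ≤ C₀α`,
`‖F − aF_*‖_{𝓗⁰} ≤ C₀α²` (`C₀` independent of `α`; `𝓗⁰ ≤ 𝓗⁴`, `Elgindi.eHkNorm_mono`); constants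
`κ, C > 0`; a datum `ε₀` with `F + ε₀` vanishing for `z ≥ M` and the global swirl-free modulated
solution `(W, Φ_W, λ, μ)` it launches (`Elgindi.IsModulatedSolution`, `W(0) = F + ε₀`,
`λ(0) = μ(0) = 1`) with `|μ_s| + |λ_s/λ + 1| ≤ Ce^{−κs}` (`s > 0`) and `‖W(s) − F‖_{𝓗⁰} ≤ Ce^{−κs}`
(`s ≥ 0`) — Thm 2's constant `C|ε₀|_{𝓗⁴}` absorbed into `C` — **and `λ` integrable on `(0, ∞)`**,
the content "there exists `T_*`" of Cor. 2.2 (`T_* = ∫₀^∞ λ`, the physical lifetime, `ds/dt = λ⁻¹`):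
the modulation estimate integrates to `λ(s) ≤ λ(0)e^{C/κ}e^{−s}`
(`Elgindi.lam_le_of_expModulation`, `Elgindi.integrableOn_Ioi_of_expModulation`; Remark 2.3: "this
corollary follows directly from Theorem 2 in view of the scaling laws"). With the datum as a
hypothesis this is `Elgindi.stableModulatedSolution_of_core_of_datum`.

## History: the merged named fact (D-0026 review of a decomposition, 2026-08-15)

This file used to declare the named fact `Elgindi.ElgindiGhoulMasmoudi2021_stableBlowupPhysical`
("the stable blow-up solution together with its physical reading"), a decomposition child of
the then named fact `ElgindiGhoulMasmoudi2021_blowupSolution` (the blow-up solution in physical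
variables, itself merged back into the obligation of `elgindi_euler_blowup` later the same day,
see `ElgindiAprioriBlowupProofs.lean`): the conclusion of `stableModulatedSolution_of_core`
above **conjoined with** physical fields `(u₀, u, p)` on `ℝ³ × [0, T_*)` in the Hölder class
`IsHolderEulerSolution α [0, T_*) u₀ u p` (datum `C^{1,α}`, divergence free, compactly supported
vorticity, finite energy, axisymmetric without swirl; axisymmetric swirl-free slices) and the
vorticity identity `‖curl u(t(s))‖_{L^∞} = λ(s)⁻¹ sup_{strip}|W(s)|`, `t(s) = ∫₀ˢ λ` — the reading
of the modulated solution in the physical variables of [ElgindiGhoulMasmoudi2021] §2.1–2.3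
(`R = ρ^α`, `Ω(R, t, θ) = λ⁻¹W(μR/λ^{1+δ}, s, θ)`, `ds/dt = λ⁻¹`) in the class of §1.3 Thm 1.
Its prove seat sized it XL, rightly: the self-similar half is the sibling named fact
`ElgindiGhoulMasmoudi2021_stabilityCore` (two papers: [Elgindi2021] §4–§9, [ElgindiGhoulMasmoudi2021]
§3–§7), and the physical half — the dictionary from a modulated solution in the weighted spaces
`𝓗ᵏ` of the `(R, θ)` variables to a classical `C^{1,α}` Euler solution on `ℝ³` — is printed in
neither source beyond single sentences ([ElgindiGhoulMasmoudi2021] p. 9: "the following stability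
theorem from which Theorem 1 and its Corollary follow"; [Elgindi2021] §9.5, p. 34: "This gives a
self similar solution … and, in particular, implies Theorem 1"; §2, p. 8: "any `C^α` solution to
(2.1) with sufficient decay at infinity and which vanishes on `r = 0` is a classical solution to
the full 3D Euler system"; the printed regularity steps are [ElgindiGhoulMasmoudi2021] Lemma 9.1,
`𝓗ᵏ ↪ L^∞`, and [Elgindi2021] Cor. 8.2, `𝓗² ↪ C^β`, `β < γ − 1`) and needs the axisymmetric
Biot–Savart law in these coordinates with `C^{1,α}` estimates up to the axis, the symmetry plane
and the origin, conservation of energy, transport of the vorticity support and a `C¹` pressure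
(none in Mathlib or the tree; not derivable from the rendered predicates, which are classical
systems in the *open* strip). So the child was not a distinct printed theorem of size M but the
parent's whole obligation minus the elementary glue, and decompositions do not recurse: it was
**merged back** into the obligation of its parent, now that of `elgindi_euler_blowup`. The def is
gone; its statement survives verbatim as the hypothesis of the proved glue
`elgindi_euler_blowup_of_stableBlowupPhysical` (`ElgindiBlowupSolutionProofs.lean`, with the
one-`α` form `elgindi_euler_blowup_of_physicalReading`), its self-similar clauses are the theorem
of this file, and its physical clauses are what a proof of **ns.S29 (i)** must still supply on top
of `ElgindiGhoulMasmoudi2021_stabilityCore`.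

Mathlib/tree search (`lean search 'stableModulated|expModulation|eHkNorm_mono'`): nothing; the
weak-form modulation lemmas of `DynamicRescalingBKM.lean` (`le_mul_exp_of_modulation`,
`integrableOn_Ioi_of_modulation`: `|λ_s/λ + 1| ≤ η < 1`) do not cover a constant `C ≥ 1`, whence the
exponentially weighted variant here. Used from Mathlib: `antitoneOn_of_deriv_nonpos`,
`HasDerivAt.log`, `HasDerivAt.exp`, `exp_neg_integrableOn_Ioi`, `Integrable.mono'`,
`ENNReal.rpow_le_rpow`.
-/

noncomputable section

open MeasureTheory Set Function Real
open scoped ENNReal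

namespace Literature.Analysis.FluidPDE

namespace Elgindi

/-! ### Corollary 2.2: the modulation estimate makes `λ` integrable -/

/-- **Decay of `λ` from the modulation estimate of Theorem 2.** If `λ > 0` is continuous on
`[0, ∞)`, differentiable on `(0, ∞)`, and `|λ_s/λ + 1| ≤ Ce^{−κs}` for `s > 0` with `κ > 0`
([ElgindiGhoulMasmoudi2021] §2.5 Thm 2, p. 9: `|μ_s| + |λ_s/λ + 1| + 𝓔(s) ≤ C𝓔₀e^{−κs}`), then
`λ(s) ≤ λ(0)e^{C/κ}e^{−s}` for `s ≥ 0`: the function `log λ(s) + s + (C/κ)e^{−κs}` has derivative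
`λ_s/λ + 1 − Ce^{−κs} ≤ 0` (Cor. 2.2, "`λ(s)exp(s) → 1/T_*`", records the limit form). [cite: ElgindiGhoulMasmoudi2021, §2.5 Thm 2 and Cor 2.2 (p. 9 of arXiv:1910.14071)] -/
theorem lam_le_of_expModulation {lam : ℝ → ℝ} {C κ : ℝ} (hcont : ContinuousOn lam (Ici 0))
    (hpos : ∀ s, 0 ≤ s → 0 < lam s) (hdiff : ∀ s, 0 < s → DifferentiableAt ℝ lam s) (hκ : 0 < κ)
    (hmod : ∀ s, 0 < s → |deriv lam s / lam s + 1| ≤ C * Real.exp (-κ * s)) {s : ℝ}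
    (hs : 0 ≤ s) : lam s ≤ lam 0 * Real.exp (C / κ) * Real.exp (-s) := by
  -- `C ≥ 0`, from the estimate at `s = 1`
  have hC : 0 ≤ C := by
    have h1 := (abs_nonneg _).trans (hmod 1 one_pos)
    exact nonneg_of_mul_nonneg_left h1 (Real.exp_pos _)
  set g : ℝ → ℝ := fun s => Real.log (lam s) + s + C / κ * Real.exp (-κ * s) with hg
  have hg_cont : ContinuousOn g (Ici 0) := by
    refine ((hcont.log fun s hs => (hpos s hs).ne').add continuousOn_id).add ?_
    exact (continuous_const.mul (Real.continuous_exp.comp (continuous_const.mul continuous_id))).continuousOn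
  have hg_deriv : ∀ s, 0 < s →
      HasDerivAt g (deriv lam s / lam s + 1 + C / κ * (Real.exp (-κ * s) * (-κ * 1))) s := by
    intro s hs
    have h1 : HasDerivAt (fun s => Real.log (lam s)) (deriv lam s / lam s) s :=
      (hdiff s hs).hasDerivAt.log (hpos s hs.le).ne'
    have h2 : HasDerivAt (fun s : ℝ => s) 1 s := hasDerivAt_id s
    have h3 : HasDerivAt (fun s : ℝ => C / κ * Real.exp (-κ * s))
        (C / κ * (Real.exp (-κ * s) * (-κ * 1))) s :=
      (((hasDerivAt_id s).const_mul (-κ)).exp).const_mul (C / κ)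
    exact (h1.add h2).add h3
  have hanti : AntitoneOn g (Ici 0) := by
    refine antitoneOn_of_deriv_nonpos (convex_Ici 0) hg_cont ?_ ?_
    · intro s hs
      rw [interior_Ici] at hs
      exact (hg_deriv s hs).differentiableAt.differentiableWithinAt
    · intro s hs
      rw [interior_Ici] at hs
      rw [(hg_deriv s hs).deriv]
      have h := (abs_le.1 (hmod s hs)).2
      have e : C / κ * (Real.exp (-κ * s) * (-κ * 1)) = -(C * Real.exp (-κ * s)) := by
        field_simp
      rw [e]
      linarith
  have hle : g s ≤ g 0 := hanti (mem_Ici.2 le_rfl) (mem_Ici.2 hs) hs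
  have hexp0 : 0 ≤ C / κ * Real.exp (-κ * s) := mul_nonneg (div_nonneg hC hκ.le) (Real.exp_pos _).le
  simp only [hg, mul_zero, Real.exp_zero, mul_one, add_zero] at hle
  have hlog : Real.log (lam s) ≤ Real.log (lam 0) + C / κ + -s := by linarith
  calc lam s = Real.exp (Real.log (lam s)) := (Real.exp_log (hpos s hs)).symm
    _ ≤ Real.exp (Real.log (lam 0) + C / κ + -s) := Real.exp_le_exp.2 hlog
    _ = lam 0 * Real.exp (C / κ) * Real.exp (-s) := by
        rw [Real.exp_add, Real.exp_add, Real.exp_log (hpos 0 le_rfl)]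

/-- **`T_* = ∫₀^∞ λ < ∞` (Corollary 2.2: "there exists `T_*`").** Under the modulation estimate of
Theorem 2 in the form `|λ_s/λ + 1| ≤ Ce^{−κs}` (`s > 0`, `κ > 0`), the positive continuous
parameter `λ` is integrable on `(0, ∞)` (comparison with `λ(0)e^{C/κ}e^{−s}`,
`lam_le_of_expModulation`), so the physical solution, `ds/dt = λ⁻¹`, lives on the bounded interval
`[0, T_*)`, `T_* = ∫₀^∞ λ`. [cite: ElgindiGhoulMasmoudi2021, §2.5 Cor 2.2 and Remark 2.3 (p. 9 of arXiv:1910.14071)] -/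
theorem integrableOn_Ioi_of_expModulation {lam : ℝ → ℝ} {C κ : ℝ} (hcont : ContinuousOn lam (Ici 0))
    (hpos : ∀ s, 0 ≤ s → 0 < lam s) (hdiff : ∀ s, 0 < s → DifferentiableAt ℝ lam s) (hκ : 0 < κ)
    (hmod : ∀ s, 0 < s → |deriv lam s / lam s + 1| ≤ C * Real.exp (-κ * s)) :
    IntegrableOn lam (Ioi 0) := by
  have hbound : IntegrableOn (fun s : ℝ => lam 0 * Real.exp (C / κ) * Real.exp (-1 * s)) (Ioi 0) :=
    (exp_neg_integrableOn_Ioi 0 one_pos).integrable.const_mul (lam 0 * Real.exp (C / κ))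
  refine Integrable.mono' hbound
    ((hcont.mono Ioi_subset_Ici_self).aestronglyMeasurable measurableSet_Ioi) ?_
  refine ae_restrict_of_forall_mem measurableSet_Ioi fun s hs => ?_
  rw [Real.norm_of_nonneg (hpos s (le_of_lt hs)).le, neg_one_mul]
  exact lam_le_of_expModulation hcont hpos hdiff hκ hmod (le_of_lt hs)

/-! ### `𝓗⁰ ≤ 𝓗⁴` -/

/-- **Monotonicity of the `𝓗ᵏ` norms in `k`**: `|f|_{𝓗ᵏ} ≤ |f|_{𝓗ᵏ'}` for `k ≤ k'`
(`eHkNormSq_mono` under the square root). [folklore] -/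
theorem eHkNorm_mono (α : ℝ) {k k' : ℕ} (hk : k ≤ k') (f : ℝ → ℝ → ℝ) :
    eHkNorm α k f ≤ eHkNorm α k' f :=
  ENNReal.rpow_le_rpow (eHkNormSq_mono α hk f) (by norm_num)

/-! ### The stable modulated solution from the core and the datum -/

/-- **The swirl-free stable modulated blow-up solution of Elgindi–Ghoul–Masmoudi, from the
stability core and the §2.6 datum.** Sources: Camb. J. Math. 9 (2021) = arXiv:1910.14071, §2.5
**Theorem 2**, p. 9 of the held text ("there exists `α₀ > 0` small so that for all `α < α₀`, there
is a `δ₀ > 0` and `κ > 0` so that for every initial `(ε₀, 𝒰₀^φ)` with `𝓔(ε₀, 𝒰₀^φ) < δ₀α^{3/2}` and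
`L₁₂(ε₀)(0) = 0`, there is an associated unique global solution … so that
`|μ_s| + |λ_s/λ + 1| + 𝓔(ε, 𝒰^φ)(s) ≤ C𝓔(ε₀, 𝒰₀^φ)e^{−κs}` for all `s ≥ 0`"), **Cor. 2.2** ("there
exists `T_*` so that `λ(s)exp(s) → 1/T_*`"), **§2.6**, p. 9 (the datum `ε₀^{M,β}`, "`ε₀ + F` is
compactly supported … will satisfy the hypothesis of Theorem 2", swirl datum zero), the profile
`F = F_* + α²g`, "`|g|_{𝓗ᵏ} ≤ C` with `C` a constant independent of `α`", §2.3, p. 7, after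
[Elgindi2021] §9.5, p. 34. **Rendering** (the self-similar clauses of the former named fact
`ElgindiGhoulMasmoudi2021_stableBlowupPhysical`, see the module docstring): given the stability
core and the datum statement, there are `C₀` and `α₀ > 0` such that for every `0 < α < α₀` there
are `δ`, a profile `(F, Φ_F)` (`Elgindi.IsProfile α δ F Φ_F`) and an amplitude `a` with
`|a − 1| ≤ C₀α`, `‖F − aF_*‖_{𝓗⁰} ≤ C₀α²`; constants `κ, C > 0`; a datum `ε₀` and a global
swirl-free modulated solution `(W, Φ_W, λ, μ)` (`Elgindi.IsModulatedSolution`) with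
`W(0) = F + ε₀`, `λ(0) = μ(0) = 1`, `F + ε₀` vanishing for `z ≥ M` on the closed `θ`-range,
`|μ_s| + |λ_s/λ + 1| ≤ Ce^{−κs}` (`s > 0`), `‖W(s) − F‖_{𝓗⁰} ≤ Ce^{−κs}` (`s ≥ 0`), and `λ`
integrable on `(0, ∞)`. Proof: `stabilityNoSwirl_of_core_of_datum` gives the profile in `𝓗⁴`
(`𝓗⁰ ≤ 𝓗⁴`), Theorem 2 and an admissible compactly supported datum; apply Theorem 2 to that
datum, absorb `C|ε₀|_{𝓗⁴}` into `C' = C|ε₀|_{𝓗⁴} + 1 > 0`, and integrate the modulation estimate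
(`integrableOn_Ioi_of_expModulation`). [cite: ElgindiGhoulMasmoudi2021, §2.5 Thm 2, Cor 2.2 and Remark 2.3 (p. 9 of arXiv:1910.14071); §2.6 (p. 9); §2.3 (p. 7–8)]
[cite: Elgindi2021, §9.5 (p. 34 of arXiv:1904.04795): the profile] -/
theorem stableModulatedSolution_of_core_of_datum (h₁ : ElgindiGhoulMasmoudi2021_stabilityCore)
    (h₂ : ElgindiGhoulMasmoudi2021_compactSupportDatum) :
    ∃ C₀ α₀ : ℝ, 0 < α₀ ∧ ∀ α : ℝ, 0 < α → α < α₀ →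
      ∃ (δ : ℝ) (F ΦF : ℝ → ℝ → ℝ) (a : ℝ),
        IsProfile α δ F ΦF ∧ |a - 1| ≤ C₀ * α ∧
        eHkNorm α 0 (F - a • fundamentalProfile α) ≤ ENNReal.ofReal (C₀ * α ^ 2) ∧
        ∃ κ C : ℝ, 0 < κ ∧ 0 < C ∧
        ∃ (ε₀ : ℝ → ℝ → ℝ) (W Φ : ℝ → ℝ → ℝ → ℝ) (lam mu : ℝ → ℝ),
          IsModulatedSolution α δ W Φ lam mu ∧ W 0 = F + ε₀ ∧ lam 0 = 1 ∧ mu 0 = 1 ∧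
          (∃ M : ℝ, ∀ z θ, M ≤ z → θ ∈ Set.Icc 0 (π / 2) → F z θ + ε₀ z θ = 0) ∧
          (∀ s, 0 < s → |deriv mu s| + |deriv lam s / lam s + 1| ≤ C * Real.exp (-κ * s)) ∧
          (∀ s, 0 ≤ s → eHkNorm α 0 (W s - F) ≤ ENNReal.ofReal (C * Real.exp (-κ * s))) ∧
          IntegrableOn lam (Set.Ioi 0) := by
  obtain ⟨C₀, α₀, hα₀, H⟩ := stabilityNoSwirl_of_core_of_datum h₁ h₂
  refine ⟨C₀, α₀, hα₀, fun α hα hαα₀ => ?_⟩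
  obtain ⟨δ, F, ΦF, hP, h4, -, -, ⟨a, ha, hFa, -⟩, δ₀, κ, C, -, hκ, hC, hii, ε₀, hε4, hεn, hεL,
    M, hM⟩ := H α hα hαα₀
  obtain ⟨W, Φ, lam, mu, hsol, hW0, hlam0, hmu0, hmod, hdec⟩ := hii ε₀ hε4 hεn hεL
  -- Theorem 2's constant `C |ε₀|_{𝓗⁴}`, absorbed into `C' > 0`
  set E : ℝ := (eHkNorm α 4 ε₀).toReal with hE
  set C' : ℝ := C * E + 1 with hC'
  have hCE : 0 ≤ C * E := mul_nonneg hC.le ENNReal.toReal_nonneg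
  have hC'pos : 0 < C' := by linarith
  have hCC' : C * E ≤ C' := by linarith
  have hmod' : ∀ s, 0 < s → |deriv mu s| + |deriv lam s / lam s + 1| ≤ C' * Real.exp (-κ * s) :=
    fun s hs => (hmod s hs).trans (mul_le_mul_of_nonneg_right hCC' (Real.exp_pos _).le)
  have hlam : ∀ s, 0 < s → |deriv lam s / lam s + 1| ≤ C' * Real.exp (-κ * s) := fun s hs =>
    le_trans (le_add_of_nonneg_left (abs_nonneg _)) (hmod' s hs)
  refine ⟨δ, F, ΦF, a, hP, ha, (eHkNorm_mono α (Nat.zero_le 4) _).trans hFa, κ, C', hκ, hC'pos,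
    ε₀, W, Φ, lam, mu, hsol, hW0, hlam0, hmu0, ⟨M, hM⟩, hmod', fun s hs => ?_, ?_⟩
  · exact (hdec s hs).trans
      (ENNReal.ofReal_le_ofReal (mul_le_mul_of_nonneg_right hCC' (Real.exp_pos _).le))
  · exact integrableOn_Ioi_of_expModulation hsol.lam_continuousOn hsol.lam_pos
      hsol.lam_differentiableAt hκ hlam

/-- **The swirl-free stable modulated blow-up solution of Elgindi–Ghoul–Masmoudi from the
stability core alone** (`stableModulatedSolution_of_core_of_datum` with the discharged §2.6 datum
`ElgindiGhoulMasmoudi2021_compactSupportDatum_holds`): the self-similar clauses of the former named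
fact `ElgindiGhoulMasmoudi2021_stableBlowupPhysical` rest on the single named fact
`ElgindiGhoulMasmoudi2021_stabilityCore`. [cite: ElgindiGhoulMasmoudi2021, §2.5 Thm 2 and Cor 2.2, §2.6 (p. 9 of arXiv:1910.14071)] -/
theorem stableModulatedSolution_of_core (h₁ : ElgindiGhoulMasmoudi2021_stabilityCore) :
    ∃ C₀ α₀ : ℝ, 0 < α₀ ∧ ∀ α : ℝ, 0 < α → α < α₀ →
      ∃ (δ : ℝ) (F ΦF : ℝ → ℝ → ℝ) (a : ℝ),
        IsProfile α δ F ΦF ∧ |a - 1| ≤ C₀ * α ∧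
        eHkNorm α 0 (F - a • fundamentalProfile α) ≤ ENNReal.ofReal (C₀ * α ^ 2) ∧
        ∃ κ C : ℝ, 0 < κ ∧ 0 < C ∧
        ∃ (ε₀ : ℝ → ℝ → ℝ) (W Φ : ℝ → ℝ → ℝ → ℝ) (lam mu : ℝ → ℝ),
          IsModulatedSolution α δ W Φ lam mu ∧ W 0 = F + ε₀ ∧ lam 0 = 1 ∧ mu 0 = 1 ∧
          (∃ M : ℝ, ∀ z θ, M ≤ z → θ ∈ Set.Icc 0 (π / 2) → F z θ + ε₀ z θ = 0) ∧
          (∀ s, 0 < s → |deriv mu s| + |deriv lam s / lam s + 1| ≤ C * Real.exp (-κ * s)) ∧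
          (∀ s, 0 ≤ s → eHkNorm α 0 (W s - F) ≤ ENNReal.ofReal (C * Real.exp (-κ * s))) ∧
          IntegrableOn lam (Set.Ioi 0) :=
  stableModulatedSolution_of_core_of_datum h₁ ElgindiGhoulMasmoudi2021_compactSupportDatum_holds

end Elgindi

end Literature.Analysis.FluidPDE
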